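import Summits.QuantumFields.BalabanUV.T4Continuum.Support.ColourPerturbedStations
import Summits.QuantumFields.BalabanUV.T4Continuum.Support.RegularBackgroundTower
import Summits.QuantumFields.BalabanUV.T4Continuum.Support.TransportedSiteAveraging
import Summits.QuantumFields.BalabanUV.T4Continuum.Support.GaugeTermLayer

/-!
# T⁴ programme, spine node NE2 (U1a) — THE BAŁABAN LAYER, TIER B (row B7 part 2 of `t4/formal/NE2/LEAVES.md`): the three summands of
# the model of `Δ_a(U_k) − Δ_a(1) ⊗ 1` ADDED into ONE `PerturbationLaws` instance with EVERY binder displayed, and ROOT B by name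

NE2 formalisation swarm, leaf prover 08 (row B7; owner rulings R1/R6, `CLAIMS.log` 2026-08-20T06:00:15Z), file 3 — the tier-B twin of
`Spine/NE2BackgroundLayer` (ROOT A).  [Balaban1985BackgroundPropagators] (3.26) p.395 prints
«Δ_a = Δ + DRD* + Q*aQ»; the tier-B MODEL of `P_k = Δ_a(U_k) − Δ_a(1) ⊗ 1` on the lifted free tower `Δ_a^{(k)} ⊗ 1` is the SUM of
 (B2) the non-abelian covariant-Laplacian summand `covPertC L M R` (`Support/ColourCovariantLaplacian`, its coefficient hypotheses read
      off the regularity class + node NE3 by `Support/RegularBackgroundTower.perturbationLaws_covariantLaplacian_of_regular`),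
 (B3) the covariant-averaging summand — a PARAMETER FAMILY `P₃` with the target shape (rows B3.*; §3 instantiates it TODAY with the
      owner's transported site-averaging model `a • sitePert L M v` of `Support/TransportedSiteAveraging`, block transporters `v` with
      NE3's consistency read by `blockTransporters_of_localRate`; the Bałaban instance proper — line-sum averaging `QvOp`, rows
      B3.a′/B3.b-inst, owner ruling R2 — plugs into the same slot BY NAME when it lands),
 (B4) the gauge-term summand — a PARAMETER FAMILY `P₄` with the target shape (row B4.b types and discharges it; §4 instantiates it TODAY
      with leaf-05's abstract `Support/GaugeTermSandwichLaw.perturbationLaws_sandwich_sub` (row B4.b's `Support/GaugeTermLayer.sandwichLaws_of_layerLaws`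
      turns its `LayerLaws` numbers into such data), its `SandwichLaws` data DISPLAYED as binders —
      trigger condition c4: a not-yet-discharged row enters as a displayed binder, never as a weakened statement).
This file:
 * §1 `perturbationLaws_add₃` (three target-shape laws add, constants add); `localRate_mono` (NE3's `LocalRate` is monotone in the class
   of towers read) and the class `tierBClass R v = {w, Dw, transporter tower}` on which a single NE3 binder can be stated;
 * §2 **`tierBPert R P₃ P₄ k = covPertC R k + P₃ k + P₄ k`** and **`perturbationLaws_tierB`**: from `hreg : RegularTransporters R α β`
   ((3.35)-shape, row B5), `hNE3 : LocalRate (bgReadings (regClass R)) C L⁻¹` (node NE3 BY NAME on `{w, Dw}`, c2/c7) and the two summand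
   laws `hP₃`, `hP₄`, the target shape for `tierBPert` with `κ_B = κ_col + κ₃ + κ₄`, `C₂^B = C₂^col + C₃ + C₄` EXPLICIT (**`kappaB`**,
   **`C2B`**); ROOT B BY NAME: **`tierB_root`** (= `NE2ColourPerturbedLayer.ne2Plus_resolvent_route_kron`: named limit with rate `L^{−k}`,
   NE2-LIP, holomorphy on `‖t‖κ_B < 1`), **`tierB_rate_at_one`** (t = 1 under the DISPLAYED threshold `κ_B < 1`), `tierB_rate_balaban`
   (Q̄ ⊗ 1), `tierB_mem_readings` (liaison);
 * §3 the B3 slot from the site-transport model + NE3: **`perturbationLaws_sitePert_of_localRate`**;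
 * §4 the B4 slot from SANDWICH DATA: **`perturbationLaws_sandwichPert`** (`P₄ k = Z⁰ᴴN⁰Z⁰ − Z¹ᴴN¹Z¹` on the lifted King tower, from two
   `SandwichLaws` + `‖Z¹ − Z⁰‖ ≤ δZ`, `‖N¹ − N⁰‖ ≤ δN`; `κ₄ = Cst(2znδZ + z²δN)`, `C₄ = C4sand … ₀ + C4sand … ₁`);
 * §5 the fully displayed instance available today: **`perturbationLaws_tierB_site_sandwich`** (ONE NE3 binder on `tierBClass R v`) and
   **`tierB_site_sandwich_rate_at_one`** — LABELS (referee c9): its B3 slot `a • sitePert v` is the (β) SITE-TRANSPORT MODEL of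
   `TransportedSiteAveraging` ([B9] (3.19) scalar shape), NOT Bałaban's (α) line-sum summand `a·n_k^d·(QcovLevᴴQcovLev − QvOpᴴQvOp ⊗ 1)`, and its
   B4 slot is sandwich DATA; the (α) instance OF RECORD is `NE2BalabanRoot.perturbationLaws_balaban` → `NE2BalabanFinal.balaban_final_rate_of_small`
   → `NE2BalabanThreshold.balaban_final_rate_of_regular` (later files); no headline may read §5 as «ROOT B for Δ_a(U)».

HONEST FRAMING (T4-DAG p. 1).  Pure assembly (the cone `perturbationLaws_add/smul/mono`) of tree theorems BY NAME; MODEL LEVEL throughout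
(colour transporters `R`, block transporters `v`, sandwich factors `Z, N` are DATA; the free operator is the VECTOR `Δ_a ⊗ 1`; GLOBAL small
field; no assertion of the dictionary B0 that `Δ_a⊗1 + tierBPert` is (3.26) entry-wise — c5); ROOT B here is CONDITIONAL on node NE3's
`LocalRate` (displayed, c2/c7), on the regularity class (displayed, c3) and on row B4.b's data (displayed, c4); the carver's scope ruling c1
stands; NOT [B9] (3.23)–(3.26) as printed (no regions `Ω_j`, no multi-scale kernels, operator norm only); NE2 NOT PROVED; NOT infinite volume,
NOT a mass gap, NOT Clay, NOT summit progress; spine 0/9 unchanged.  HONEST DEPENDENCY: continuum YM on T⁴ ⇐ BetaPertH ∧ nine spine estimates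
(0/9 proved); BetaPertH ⇐ (D1) ∧ (D4) ∧ CAP+tail; G-an2-4 gates asym, D1 and NE2/3/4.  ABSOLUTE RULE kept; no `sorry`.
-/

noncomputable section

open scoped BigOperators ComplexConjugate Matrix Matrix.Norms.L2Operator Kronecker
open Filter Topology

namespace Summit.QuantumFields.BalabanUV.T4Continuum.NE2BalabanLayer

open Literature.MathematicalPhysics.QuantumFieldTheory.Balaban1983to89.B5Prop11Plancherel (Cst Cst_nonneg)
open Literature.MathematicalPhysics.QuantumFieldTheory.Balaban1983to89.T4EtaRateMin (LocalRate)
open Summit.QuantumFields.BalabanUV.T4Continuum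
open Summit.QuantumFields.BalabanUV.T4Continuum.CovariantAveragingTower (TowerLimitRate)
open Summit.QuantumFields.BalabanUV.T4Continuum.BalabanAveragedTowerUnit (idx Qlev QBlev)
open Summit.QuantumFields.BalabanUV.T4Continuum.BackgroundResolventTower
open Summit.QuantumFields.BalabanUV.T4Continuum.KingPairingPlantedLaw
open Summit.QuantumFields.BalabanUV.T4Continuum.NE2PerturbedLayer
open Summit.QuantumFields.BalabanUV.T4Continuum.PerturbationAlgebra
open Summit.QuantumFields.BalabanUV.T4Continuum.KroneckerLift
open Summit.QuantumFields.BalabanUV.T4Continuum.FirstOrderAdjointModel (conjTranspose_inv_calDalev)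
open Summit.QuantumFields.BalabanUV.T4Continuum.ColourCovariantLaplacian (covPertC kappaCol C2col)
open Summit.QuantumFields.BalabanUV.T4Continuum.NE2FromNE3 (bgReadings)
open Summit.QuantumFields.BalabanUV.T4Continuum.RegularBackgroundTower
open Summit.QuantumFields.BalabanUV.T4Continuum.TransportedSiteAveraging (BlockTransporters sitePert C2site
  perturbationLaws_transportedSite blockTransporters_of_localRate)
open Summit.QuantumFields.BalabanUV.T4Continuum.GaugeTermSandwichLaw
open Summit.QuantumFields.BalabanUV.T4Continuum.NE2ColourPerturbedLayer
open Summit.QuantumFields.BalabanUV.T4Continuum.ColourPerturbedStations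

variable {d : ℕ} (L : ℕ) [NeZero L] (M : Fin d → ℕ) [hM : ∀ μ, NeZero (M μ)] (a : ℝ) (ha : 0 < a)
variable {o : Type*} [Fintype o] [DecidableEq o]

/-! ## §1 Three laws add; one NE3 binder for all coefficient towers -/

section Generic

variable {ι : ℕ → Type*} [∀ k, Fintype (ι k)] [∀ k, DecidableEq (ι k)]
variable {D : (k : ℕ) → Matrix (ι k) (ι k) ℂ} {J : (k : ℕ) → Matrix (ι (k + 1)) (ι k) ℂ}

/-- **THREE TARGET-SHAPE LAWS ADD** (geometric consistency constants add). [folklore] -/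
theorem perturbationLaws_add₃ {P₁ P₂ P₃ : (k : ℕ) → Matrix (ι k) (ι k) ℂ} {κ₁ κ₂ κ₃ C₁ C₂ C₃ ρ : ℝ}
    (h₁ : PerturbationLaws D P₁ J κ₁ (fun k => C₁ * ρ ^ k)) (h₂ : PerturbationLaws D P₂ J κ₂ (fun k => C₂ * ρ ^ k))
    (h₃ : PerturbationLaws D P₃ J κ₃ (fun k => C₃ * ρ ^ k)) :
    PerturbationLaws D (fun k => P₁ k + P₂ k + P₃ k) J (κ₁ + κ₂ + κ₃) (fun k => (C₁ + C₂ + C₃) * ρ ^ k) :=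
  perturbationLaws_mono (perturbationLaws_add (perturbationLaws_add h₁ h₂) h₃) le_rfl fun k => le_of_eq (by ring)

end Generic

omit [NeZero L] hM [Fintype o] [DecidableEq o] in
/-- **NE3's `LocalRate` IS MONOTONE IN THE CLASS READ**: a rate for the readings of a class `𝒟` gives the same rate for every sub-class.
[folklore] -/
theorem localRate_mono {𝒟 𝒟' : Set ((k : ℕ) → Fin d → (idx L M k → Matrix o o ℂ))} (hsub : 𝒟' ⊆ 𝒟) {C θ : ℝ}
    (h : LocalRate (bgReadings L M 𝒟) C θ) : LocalRate (bgReadings L M 𝒟') C θ :=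
  fun k W hW x => h k W (hsub hW) x

/-- the block-transporter tower as a (direction-independent) coefficient tower read by NE3. [folklore] -/
def transTower (v : (k : ℕ) → idx L M k → Matrix o o ℂ) : (k : ℕ) → Fin d → (idx L M k → Matrix o o ℂ) := fun k _ => v k

/-- **THE ONE CLASS OF COEFFICIENT TOWERS NODE NE3 IS ASKED ABOUT** for tier B: the connection `w = L^k(R − 1)`, its lattice derivative
`Dw` (`RegularBackgroundTower.regClass`) and the block-transporter tower. [folklore] -/
def tierBClass (R : (k : ℕ) → Fin d → (idx L M k → Matrix o o ℂ)) (v : (k : ℕ) → idx L M k → Matrix o o ℂ) :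
    Set ((k : ℕ) → Fin d → (idx L M k → Matrix o o ℂ)) :=
  insert (transTower L M v) (regClass L M R)

omit [NeZero L] hM [Fintype o] in
/-- `{w, Dw} ⊆ tierBClass`. [folklore] -/
theorem regClass_subset_tierBClass (R : (k : ℕ) → Fin d → (idx L M k → Matrix o o ℂ)) (v : (k : ℕ) → idx L M k → Matrix o o ℂ) :
    regClass L M R ⊆ tierBClass L M R v :=
  Set.subset_insert _ _

omit [NeZero L] hM [Fintype o] in
/-- the transporter tower lies in `tierBClass`. [folklore] -/
theorem transTower_mem_tierBClass (R : (k : ℕ) → Fin d → (idx L M k → Matrix o o ℂ)) (v : (k : ℕ) → idx L M k → Matrix o o ℂ) :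
    transTower L M v ∈ tierBClass L M R v :=
  Set.mem_insert _ _

/-! ## §2 The assembled tier-B perturbation, its `PerturbationLaws`, and ROOT B by name -/

/-- **THE TIER-B PERTURBATION** `P_k = (Δ^{R_k} − Δ^1 ⊗ 1) + P₃,k + P₄,k` — rows B2 + B3 + B4 of the model of `Δ_a(U_k) − Δ_a(1) ⊗ 1`
([B9] (3.26) shape «Δ_a = Δ + DRD* + Q*aQ»), the covariant-averaging summand `P₃` and the gauge-term summand `P₄` parameter families
typed by rows B3/B4. [cite: Balaban1985BackgroundPropagators, (3.26) p.395 (shape)] [folklore] -/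
def tierBPert (R : (k : ℕ) → Fin d → (idx L M k → Matrix o o ℂ)) (P₃ P₄ : (k : ℕ) → Matrix (idx L M k × o) (idx L M k × o) ℂ)
    (k : ℕ) : Matrix (idx L M k × o) (idx L M k × o) ℂ :=
  covPertC L M R k + P₃ k + P₄ k

/-- the tier-B relative bound `κ_B = κ_col(α, max β β_NE3, d(α² + 2β)) + κ₃ + κ₄` (`β_NE3 = 2·card o·C`). [folklore] -/
def kappaB (o : Type*) [Fintype o] (d : ℕ) (a α β C κ₃ κ₄ : ℝ) : ℝ :=
  kappaCol o d a α (max β (betaNE3 o C)) (d * (α ^ 2 + 2 * β)) + κ₃ + κ₄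

/-- the tier-B consistency constant `C₂^B = C₂^col + C₃ + C₄`. [folklore] -/
def C2B (o : Type*) [Fintype o] (d L : ℕ) (a α β C C₃ C₄ : ℝ) : ℝ :=
  C2col o d L a α (max β (betaNE3 o C)) (d * (2 * α * (betaNE3 o C + β) + 2 * betaNE3 o C)) + C₃ + C₄

/-- **`PerturbationLaws` FOR THE ASSEMBLED TIER-B PERTURBATION** (`d ≥ 1`), every binder displayed: the regularity class `hreg` (row B5's
(3.35)-shape on the colour transporters `R`), `hNE3 : LocalRate (bgReadings (regClass R)) C L⁻¹` (node U1b/NE3's predicate BY NAME on the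
class `{w, Dw}` read by the covariant-Laplacian summand), and the two summand laws `hP₃` (row B3), `hP₄` (row B4).  Conclusion: the target
shape for `tierBPert R P₃ P₄` with `κ_B`, `C₂^B·L^{−k}`. [cite: Balaban1985BackgroundPropagators, (3.26) p.395, (3.35) p.396 (shapes)] [folklore] -/
theorem perturbationLaws_tierB (hd : 1 ≤ d) {R : (k : ℕ) → Fin d → (idx L M k → Matrix o o ℂ)} {α β : ℝ}
    (hreg : RegularTransporters L M R α β) {C : ℝ} (hC : 0 ≤ C) (hNE3 : LocalRate (bgReadings L M (regClass L M R)) C ((L : ℝ)⁻¹))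
    {P₃ P₄ : (k : ℕ) → Matrix (idx L M k × o) (idx L M k × o) ℂ} {κ₃ C₃ κ₄ C₄ : ℝ}
    (hP₃ : PerturbationLaws (fun k => calDalev L M a ha k ⊗ₖ (1 : Matrix o o ℂ)) P₃ (fun k => JpcT L M k ⊗ₖ (1 : Matrix o o ℂ)) κ₃
      (fun k => C₃ * ((L : ℝ)⁻¹) ^ k))
    (hP₄ : PerturbationLaws (fun k => calDalev L M a ha k ⊗ₖ (1 : Matrix o o ℂ)) P₄ (fun k => JpcT L M k ⊗ₖ (1 : Matrix o o ℂ)) κ₄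
      (fun k => C₄ * ((L : ℝ)⁻¹) ^ k)) :
    PerturbationLaws (fun k => calDalev L M a ha k ⊗ₖ (1 : Matrix o o ℂ)) (tierBPert L M R P₃ P₄)
      (fun k => JpcT L M k ⊗ₖ (1 : Matrix o o ℂ)) (kappaB o d a α β C κ₃ κ₄) (fun k => C2B o d L a α β C C₃ C₄ * ((L : ℝ)⁻¹) ^ k) :=
  perturbationLaws_add₃ (perturbationLaws_covariantLaplacian_of_regular L M a ha hd hreg hC hNE3) hP₃ hP₄

/-- **ROOT B FOR THE ASSEMBLED TIER-B PERTURBATION, EVERY BINDER DISPLAYED** (`L ≥ 2`, `d ≥ 1`): for every coupling `‖t‖κ_B < 1` the lifted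
King-averaged unit-lattice colour covariances of `(Δ_a^{(k)} ⊗ 1 + t·P_k)⁻¹` CONVERGE to the NAMED limit `pertLimC` with
`‖c_k(t) − c_∞(t)‖ ≤ Cpert(t)·L^{−k}/(1 − L^{−1})`, `‖c_∞(t) − c_∞(0)‖ ≤ ‖t‖κ_B·Cst·(1 − ‖t‖κ_B)^{−1}` (NE2-LIP), and `c_∞` is HOLOMORPHIC on the
Neumann disc — CONDITIONAL on `hNE3` (node NE3), `hreg` (regularity class) and the summand laws `hP₃`, `hP₄` (rows B3/B4), all displayed.
NE2 is NOT proved by this. [cite: King1986, Lemma 4.5 (4.32)/(4.38) p.674 (scalar template); Balaban1985BackgroundPropagators, (3.26) p.395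
(shape)] [folklore] -/
theorem tierB_root (hL : 2 ≤ L) (hd : 1 ≤ d) {R : (k : ℕ) → Fin d → (idx L M k → Matrix o o ℂ)} {α β : ℝ}
    (hreg : RegularTransporters L M R α β) {C : ℝ} (hC : 0 ≤ C) (hNE3 : LocalRate (bgReadings L M (regClass L M R)) C ((L : ℝ)⁻¹))
    {P₃ P₄ : (k : ℕ) → Matrix (idx L M k × o) (idx L M k × o) ℂ} {κ₃ C₃ κ₄ C₄ : ℝ}
    (hP₃ : PerturbationLaws (fun k => calDalev L M a ha k ⊗ₖ (1 : Matrix o o ℂ)) P₃ (fun k => JpcT L M k ⊗ₖ (1 : Matrix o o ℂ)) κ₃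
      (fun k => C₃ * ((L : ℝ)⁻¹) ^ k))
    (hP₄ : PerturbationLaws (fun k => calDalev L M a ha k ⊗ₖ (1 : Matrix o o ℂ)) P₄ (fun k => JpcT L M k ⊗ₖ (1 : Matrix o o ℂ)) κ₄
      (fun k => C₄ * ((L : ℝ)⁻¹) ^ k)) {t : ℂ} (ht : ‖t‖ * kappaB o d a α β C κ₃ κ₄ < 1) :
    Tendsto (pertCovC L M a ha (tierBPert L M R P₃ P₄) t) atTop (𝓝 (pertLimC L M a ha (tierBPert L M R P₃ P₄) t)) ∧
      Tendsto (pertCovC L M a ha (tierBPert L M R P₃ P₄) 0) atTop (𝓝 (pertLimC L M a ha (tierBPert L M R P₃ P₄) 0)) ∧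
      (∀ k, ‖pertCovC L M a ha (tierBPert L M R P₃ P₄) t k - pertLimC L M a ha (tierBPert L M R P₃ P₄) t‖
          ≤ Cpert (kappaB o d a α β C κ₃ κ₄) (2 * d * Cst d a) (CJ d a) (C2B o d L a α β C C₃ C₄) 0 t * ((L : ℝ)⁻¹) ^ k
              / (1 - (L : ℝ)⁻¹)) ∧
      ‖pertLimC L M a ha (tierBPert L M R P₃ P₄) t - pertLimC L M a ha (tierBPert L M R P₃ P₄) 0‖
          ≤ ‖t‖ * kappaB o d a α β C κ₃ κ₄ * Cst d a * (1 - ‖t‖ * kappaB o d a α β C κ₃ κ₄)⁻¹ ∧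
      DifferentiableOn ℂ (pertLimC L M a ha (tierBPert L M R P₃ P₄)) {t : ℂ | ‖t‖ * kappaB o d a α β C κ₃ κ₄ < 1} :=
  ne2Plus_resolvent_route_kron L M a ha hL (perturbationLaws_tierB L M a ha hd hreg hC hNE3 hP₃ hP₄) ht

/-- **THE PHYSICAL VALUE `t = 1`** under the DISPLAYED small-field threshold `κ_B < 1` (King averaging `Q_L ⊗ 1`): the tower limit with rate
`L^{−k}` for `(Δ_a^{(k)} ⊗ 1 + P_k)⁻¹`. [folklore] -/
theorem tierB_rate_at_one (hL : 2 ≤ L) (hd : 1 ≤ d) {R : (k : ℕ) → Fin d → (idx L M k → Matrix o o ℂ)} {α β : ℝ}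
    (hreg : RegularTransporters L M R α β) {C : ℝ} (hC : 0 ≤ C) (hNE3 : LocalRate (bgReadings L M (regClass L M R)) C ((L : ℝ)⁻¹))
    {P₃ P₄ : (k : ℕ) → Matrix (idx L M k × o) (idx L M k × o) ℂ} {κ₃ C₃ κ₄ C₄ : ℝ}
    (hP₃ : PerturbationLaws (fun k => calDalev L M a ha k ⊗ₖ (1 : Matrix o o ℂ)) P₃ (fun k => JpcT L M k ⊗ₖ (1 : Matrix o o ℂ)) κ₃
      (fun k => C₃ * ((L : ℝ)⁻¹) ^ k))
    (hP₄ : PerturbationLaws (fun k => calDalev L M a ha k ⊗ₖ (1 : Matrix o o ℂ)) P₄ (fun k => JpcT L M k ⊗ₖ (1 : Matrix o o ℂ)) κ₄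
      (fun k => C₄ * ((L : ℝ)⁻¹) ^ k)) (hsmall : kappaB o d a α β C κ₃ κ₄ < 1) :
    TowerLimitRate (fun k => Qlev L M k ⊗ₖ (1 : Matrix o o ℂ)) ((L : ℝ) ^ d)
      (fun k => (calDalev L M a ha k ⊗ₖ (1 : Matrix o o ℂ) + tierBPert L M R P₃ P₄ k)⁻¹)
      (Cpert (kappaB o d a α β C κ₃ κ₄) (2 * d * Cst d a) (CJ d a) (C2B o d L a α β C C₃ C₄) 0 1) ((L : ℝ)⁻¹) := by
  have h := towerLimitRate_perturbed_king_kron L M a ha hL (perturbationLaws_tierB L M a ha hd hreg hC hNE3 hP₃ hP₄) (t := 1)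
    (by rwa [norm_one, one_mul])
  simpa only [one_smul] using h

/-- **… WITH BAŁABAN's AVERAGING `Q̄ ⊗ 1`** (pairing defect `dLCst·L^{−k}`), every `‖t‖κ_B < 1`. [folklore] -/
theorem tierB_rate_balaban (hL : 2 ≤ L) (hd : 1 ≤ d) {R : (k : ℕ) → Fin d → (idx L M k → Matrix o o ℂ)} {α β : ℝ}
    (hreg : RegularTransporters L M R α β) {C : ℝ} (hC : 0 ≤ C) (hNE3 : LocalRate (bgReadings L M (regClass L M R)) C ((L : ℝ)⁻¹))
    {P₃ P₄ : (k : ℕ) → Matrix (idx L M k × o) (idx L M k × o) ℂ} {κ₃ C₃ κ₄ C₄ : ℝ}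
    (hP₃ : PerturbationLaws (fun k => calDalev L M a ha k ⊗ₖ (1 : Matrix o o ℂ)) P₃ (fun k => JpcT L M k ⊗ₖ (1 : Matrix o o ℂ)) κ₃
      (fun k => C₃ * ((L : ℝ)⁻¹) ^ k))
    (hP₄ : PerturbationLaws (fun k => calDalev L M a ha k ⊗ₖ (1 : Matrix o o ℂ)) P₄ (fun k => JpcT L M k ⊗ₖ (1 : Matrix o o ℂ)) κ₄
      (fun k => C₄ * ((L : ℝ)⁻¹) ^ k)) {t : ℂ} (ht : ‖t‖ * kappaB o d a α β C κ₃ κ₄ < 1) :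
    TowerLimitRate (fun k => QBlev L M k ⊗ₖ (1 : Matrix o o ℂ)) ((L : ℝ) ^ d)
      (fun k => (calDalev L M a ha k ⊗ₖ (1 : Matrix o o ℂ) + t • tierBPert L M R P₃ P₄ k)⁻¹)
      (Cpert (kappaB o d a α β C κ₃ κ₄) (2 * d * Cst d a) (CJ d a) (C2B o d L a α β C C₃ C₄) (d * L * Cst d a) t) ((L : ℝ)⁻¹) :=
  towerLimitRate_perturbed_balaban_kron L M a ha hL (perturbationLaws_tierB L M a ha hd hreg hC hNE3 hP₃ hP₄) ht

/-- **… AND THE LIAISON SHAPE**: the assembled perturbation lies in the colour readings class at `(κ_B, C₂^B)`, so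
`ColourPerturbedStations.localRate_pertCovC` applies to it (an instance of node U1b's currency for the tier-B species, conditional on the
displayed binders). [folklore] -/
theorem tierB_mem_readings (hd : 1 ≤ d) {R : (k : ℕ) → Fin d → (idx L M k → Matrix o o ℂ)} {α β : ℝ}
    (hreg : RegularTransporters L M R α β) {C : ℝ} (hC : 0 ≤ C) (hNE3 : LocalRate (bgReadings L M (regClass L M R)) C ((L : ℝ)⁻¹))
    {P₃ P₄ : (k : ℕ) → Matrix (idx L M k × o) (idx L M k × o) ℂ} {κ₃ C₃ κ₄ C₄ : ℝ}
    (hP₃ : PerturbationLaws (fun k => calDalev L M a ha k ⊗ₖ (1 : Matrix o o ℂ)) P₃ (fun k => JpcT L M k ⊗ₖ (1 : Matrix o o ℂ)) κ₃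
      (fun k => C₃ * ((L : ℝ)⁻¹) ^ k))
    (hP₄ : PerturbationLaws (fun k => calDalev L M a ha k ⊗ₖ (1 : Matrix o o ℂ)) P₄ (fun k => JpcT L M k ⊗ₖ (1 : Matrix o o ℂ)) κ₄
      (fun k => C₄ * ((L : ℝ)⁻¹) ^ k)) (t : ℂ) :
    tierBPert L M R P₃ P₄ ∈ (pertReadingsC L M a ha o (kappaB o d a α β C κ₃ κ₄) (C2B o d L a α β C C₃ C₄) t).dom :=
  perturbationLaws_tierB L M a ha hd hreg hC hNE3 hP₃ hP₄

/-! ## §3 The B3 slot from the transported site-averaging model and NE3 by name -/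

/-- **THE COVARIANT-AVERAGING SLOT, SITE-TRANSPORT MODEL**: block transporters `v` in the small field `‖v_k(x) − 1‖ ≤ α′` whose tower lies in
a class `𝒟` with `LocalRate (bgReadings 𝒟) C L⁻¹` (node NE3 BY NAME) give the target shape for `P₃,k = a • sitePert v k` with
`κ₃ = a·α′(2+α′)Cst`, `C₃ = a·C2site(α′, 2·card o·C)` (owner's `perturbationLaws_transportedSite` + `blockTransporters_of_localRate`).
[cite: Balaban1985BackgroundPropagators, (3.19) p.393, (3.24) p.394 (shapes)] [folklore] -/
theorem perturbationLaws_sitePert_of_localRate (hd : 1 ≤ d) {𝒟 : Set ((k : ℕ) → Fin d → (idx L M k → Matrix o o ℂ))} {C α' : ℝ}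
    (hC : 0 ≤ C) (hα' : 0 ≤ α') (hNE3 : LocalRate (bgReadings L M 𝒟) C ((L : ℝ)⁻¹)) {v : (k : ℕ) → idx L M k → Matrix o o ℂ}
    (hv𝒟 : transTower L M v ∈ 𝒟) (hnear : ∀ k i, ‖v k i - 1‖ ≤ α') :
    PerturbationLaws (fun k => calDalev L M a ha k ⊗ₖ (1 : Matrix o o ℂ)) (fun k => (a : ℂ) • sitePert L M v k)
      (fun k => JpcT L M k ⊗ₖ (1 : Matrix o o ℂ)) (‖(a : ℂ)‖ * (α' * (2 + α') * Cst d a))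
      (fun k => ‖(a : ℂ)‖ * C2site d a α' (2 * (Fintype.card o : ℝ) * C) * ((L : ℝ)⁻¹) ^ k) := by
  have hv : BlockTransporters L M v α' (2 * (Fintype.card o : ℝ) * C) := blockTransporters_of_localRate L M hd hC hα' hNE3 hv𝒟 hnear
  have h := perturbationLaws_smul (a : ℂ) (perturbationLaws_transportedSite L M a ha hv)
  exact perturbationLaws_mono h le_rfl fun k => le_of_eq (mul_assoc _ _ _).symm

/-! ## §4 The B4 slot from sandwich data (row B4.b's abstract reading) -/

variable {υ : Type*} [Fintype υ] [DecidableEq υ]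

/-- **THE GAUGE-TERM SLOT AS A DIFFERENCE OF TWO SANDWICH FAMILIES** `P₄,k = Z⁰_kᴴN⁰_kZ⁰_k − Z¹_kᴴN¹_kZ¹_k` (row B4.b's factorised reading of
`−(D_UP(U)D_U* − ∂P∂* ⊗ 1)`, [B9] (3.25)–(3.26); `Z¹, N¹` the `U`-dependent factors, `Z⁰, N⁰` their `U = 1` versions — DATA here).
[cite: Balaban1985BackgroundPropagators, (3.25) p.394, (3.26) p.395 (shapes)] [folklore] -/
def sandwichPert (Z₁ Z₀ : (k : ℕ) → Matrix υ (idx L M k × o) ℂ) (N₁ N₀ : (k : ℕ) → Matrix υ υ ℂ) (k : ℕ) :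
    Matrix (idx L M k × o) (idx L M k × o) ℂ :=
  sandwich Z₀ N₀ k - sandwich Z₁ N₁ k

/-- the consistency constant of ONE sandwich family on the lifted King tower: `Cst·z·n·(2Cζ + z(2CJ + 2dCst)) + Cst²z²Cν`. [folklore] -/
def C4sand (d : ℕ) (a z n Cζ Cν : ℝ) : ℝ :=
  Cst d a * z * n * (2 * Cζ + z * (2 * CJ d a + 2 * d * Cst d a)) + Cst d a * Cst d a * z * z * Cν

/-- **`PerturbationLaws` FOR THE GAUGE-TERM SLOT FROM SANDWICH DATA** on the lifted King tower: two `SandwichLaws` with geometric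
consistencies (`Cζ·L^{−k}`, `Cν·L^{−k}`) and the difference sizes `δZ`, `δN` give the target shape with `κ₄ = Cst·(2znδZ + z²δN)`,
`C₄ = C4sand(…⁰) + C4sand(…¹)` (leaf-05's `perturbationLaws_sandwich_sub` + `Esand_le_geometric`, instantiated). [folklore] -/
theorem perturbationLaws_sandwichPert {Z₁ Z₀ : (k : ℕ) → Matrix υ (idx L M k × o) ℂ} {N₁ N₀ : (k : ℕ) → Matrix υ υ ℂ}
    {z n δZ δN Cζ₁ Cν₁ Cζ₀ Cν₀ : ℝ}
    (h₁ : SandwichLaws (fun k => calDalev L M a ha k ⊗ₖ (1 : Matrix o o ℂ)) (fun k => JpcT L M k ⊗ₖ (1 : Matrix o o ℂ)) Z₁ N₁ z n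
      (fun k => Cζ₁ * ((L : ℝ)⁻¹) ^ k) (fun k => Cν₁ * ((L : ℝ)⁻¹) ^ k))
    (h₀ : SandwichLaws (fun k => calDalev L M a ha k ⊗ₖ (1 : Matrix o o ℂ)) (fun k => JpcT L M k ⊗ₖ (1 : Matrix o o ℂ)) Z₀ N₀ z n
      (fun k => Cζ₀ * ((L : ℝ)⁻¹) ^ k) (fun k => Cν₀ * ((L : ℝ)⁻¹) ^ k))
    (hdZ : ∀ k, ‖Z₁ k - Z₀ k‖ ≤ δZ) (hdN : ∀ k, ‖N₁ k - N₀ k‖ ≤ δN) :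
    PerturbationLaws (fun k => calDalev L M a ha k ⊗ₖ (1 : Matrix o o ℂ)) (sandwichPert L M Z₁ Z₀ N₁ N₀)
      (fun k => JpcT L M k ⊗ₖ (1 : Matrix o o ℂ)) (Cst d a * (2 * z * n * δZ + z * z * δN))
      (fun k => (C4sand d a z n Cζ₀ Cν₀ + C4sand d a z n Cζ₁ Cν₁) * ((L : ℝ)⁻¹) ^ k) := by
  have hdZ' : ∀ k, ‖Z₀ k - Z₁ k‖ ≤ δZ := fun k => by rw [norm_sub_rev]; exact hdZ k
  have hdN' : ∀ k, ‖N₀ k - N₁ k‖ ≤ δN := fun k => by rw [norm_sub_rev]; exact hdN k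
  have h := perturbationLaws_sandwich_sub (freeTowerLaws_king_kron L M a ha o) (opNorm_inv_calDalev_kron_le L M a ha)
    (GaugeTermLayer.inv_kron_conjTranspose L M a ha) h₀ h₁ hdZ' hdN'
  obtain ⟨hz, hn⟩ := h₀.nonneg
  have hg : 0 ≤ Cst d a := Cst_nonneg d a
  refine perturbationLaws_mono h le_rfl fun k => ?_
  have e0 := Esand_le_geometric (e₀ := fun k => 2 * d * Cst d a * ((L : ℝ)⁻¹) ^ k) (e₁ := fun k => CJ d a * ((L : ℝ)⁻¹) ^ k)
    hg hz hn (ζ := fun k => Cζ₀ * ((L : ℝ)⁻¹) ^ k) (ν := fun k => Cν₀ * ((L : ℝ)⁻¹) ^ k) (ρ := (L : ℝ)⁻¹)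
    (C₀ := 2 * d * Cst d a) (C₁ := CJ d a) (Cζ := Cζ₀) (Cν := Cν₀)
    (fun k => le_rfl) (fun k => le_rfl) (fun k => le_rfl) (fun k => le_rfl) k
  have e1 := Esand_le_geometric (e₀ := fun k => 2 * d * Cst d a * ((L : ℝ)⁻¹) ^ k) (e₁ := fun k => CJ d a * ((L : ℝ)⁻¹) ^ k)
    hg hz hn (ζ := fun k => Cζ₁ * ((L : ℝ)⁻¹) ^ k) (ν := fun k => Cν₁ * ((L : ℝ)⁻¹) ^ k) (ρ := (L : ℝ)⁻¹)
    (C₀ := 2 * d * Cst d a) (C₁ := CJ d a) (Cζ := Cζ₁) (Cν := Cν₁)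
    (fun k => le_rfl) (fun k => le_rfl) (fun k => le_rfl) (fun k => le_rfl) k
  refine (add_le_add e0 e1).trans (le_of_eq ?_)
  simp only [C4sand]
  ring

/-! ## §5 The fully displayed instance available today ((β) SITE-TRANSPORT B3 MODEL + sandwich B4 DATA — NOT the (α) instance of record), ONE NE3 binder -/

/-- **THE FULLY DISPLAYED TIER-B LAW FOR THE (β) SITE-TRANSPORT MODEL WITH SANDWICH DATA** — `tierBPert R (a • sitePert v) (sandwichPert Z₁ Z₀ N₁ N₀)`:
the B3 slot is the (β) site-transport model of `TransportedSiteAveraging` ([B9] (3.19) scalar shape; NOT Bałaban's (α) covariant line-sum averaging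
summand, whose instance of record is `NE2BalabanRoot.perturbationLaws_balaban`), the B4 slot is sandwich DATA (`h₁ h₀ hdZ hdN`; the gauge term on row
data is `NE2BalabanFinal.perturbationLaws_gaugeSlot_regular`) — referee c9 labels.  Binders: `hreg` (row B5), `hnear` (block transporters in the small
field), ONE `hNE3 : LocalRate (bgReadings (tierBClass R v)) C L⁻¹` (node NE3 BY NAME on the class `{w, Dw, transporter tower}`), `h₁ h₀ hdZ hdN`
(row B4.b's sandwich data).  Model level; NE2 NOT proved by this. [folklore] -/
theorem perturbationLaws_tierB_site_sandwich (hd : 1 ≤ d) {R : (k : ℕ) → Fin d → (idx L M k → Matrix o o ℂ)} {α β : ℝ}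
    (hreg : RegularTransporters L M R α β) {v : (k : ℕ) → idx L M k → Matrix o o ℂ} {α' : ℝ} (hα' : 0 ≤ α')
    (hnear : ∀ k i, ‖v k i - 1‖ ≤ α') {C : ℝ} (hC : 0 ≤ C) (hNE3 : LocalRate (bgReadings L M (tierBClass L M R v)) C ((L : ℝ)⁻¹))
    {Z₁ Z₀ : (k : ℕ) → Matrix υ (idx L M k × o) ℂ} {N₁ N₀ : (k : ℕ) → Matrix υ υ ℂ} {z n δZ δN Cζ₁ Cν₁ Cζ₀ Cν₀ : ℝ}
    (h₁ : SandwichLaws (fun k => calDalev L M a ha k ⊗ₖ (1 : Matrix o o ℂ)) (fun k => JpcT L M k ⊗ₖ (1 : Matrix o o ℂ)) Z₁ N₁ z n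
      (fun k => Cζ₁ * ((L : ℝ)⁻¹) ^ k) (fun k => Cν₁ * ((L : ℝ)⁻¹) ^ k))
    (h₀ : SandwichLaws (fun k => calDalev L M a ha k ⊗ₖ (1 : Matrix o o ℂ)) (fun k => JpcT L M k ⊗ₖ (1 : Matrix o o ℂ)) Z₀ N₀ z n
      (fun k => Cζ₀ * ((L : ℝ)⁻¹) ^ k) (fun k => Cν₀ * ((L : ℝ)⁻¹) ^ k))
    (hdZ : ∀ k, ‖Z₁ k - Z₀ k‖ ≤ δZ) (hdN : ∀ k, ‖N₁ k - N₀ k‖ ≤ δN) :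
    PerturbationLaws (fun k => calDalev L M a ha k ⊗ₖ (1 : Matrix o o ℂ))
      (tierBPert L M R (fun k => (a : ℂ) • sitePert L M v k) (sandwichPert L M Z₁ Z₀ N₁ N₀))
      (fun k => JpcT L M k ⊗ₖ (1 : Matrix o o ℂ))
      (kappaB o d a α β C (‖(a : ℂ)‖ * (α' * (2 + α') * Cst d a)) (Cst d a * (2 * z * n * δZ + z * z * δN)))
      (fun k => C2B o d L a α β C (‖(a : ℂ)‖ * C2site d a α' (2 * (Fintype.card o : ℝ) * C))
        (C4sand d a z n Cζ₀ Cν₀ + C4sand d a z n Cζ₁ Cν₁) * ((L : ℝ)⁻¹) ^ k) :=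
  perturbationLaws_tierB L M a ha hd hreg hC (localRate_mono L M (regClass_subset_tierBClass L M R v) hNE3)
    (perturbationLaws_sitePert_of_localRate L M a ha hd hC hα' hNE3 (transTower_mem_tierBClass L M R v) hnear)
    (perturbationLaws_sandwichPert L M a ha h₁ h₀ hdZ hdN)

/-- **THE RATE AT `t = 1` FOR THE (β) SITE-TRANSPORT MODEL WITH SANDWICH DATA, FULLY DISPLAYED** (`L ≥ 2`, `d ≥ 1`; referee c9 labels: B3
slot = (β) site-transport MODEL, B4 slot = sandwich DATA — NOT ROOT B for the typed `Δ_a(U)` of record, which is `NE2BalabanThreshold.balaban_final_rate_of_regular`):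
under the small-field threshold `κ_B < 1` (explicit in `card o, d, a, α, β, C, α′, z, n, δZ, δN`), the lifted King-averaged unit-lattice covariances of
`(Δ_a^{(k)} ⊗ 1 + P_k)⁻¹`, `P = tierBPert R (a • sitePert v) (sandwichPert …)`, CONVERGE with rate `L^{−k}` — CONDITIONAL on node NE3 (`hNE3`), the
regularity class (`hreg`, `hnear`) and row B4.b's sandwich data (`h₁ h₀ hdZ hdN`), all displayed.  NE2 is NOT proved by it; the carver's scope ruling
(c1) is about statements of this form. [folklore] -/
theorem tierB_site_sandwich_rate_at_one (hL : 2 ≤ L) (hd : 1 ≤ d) {R : (k : ℕ) → Fin d → (idx L M k → Matrix o o ℂ)} {α β : ℝ}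
    (hreg : RegularTransporters L M R α β) {v : (k : ℕ) → idx L M k → Matrix o o ℂ} {α' : ℝ} (hα' : 0 ≤ α')
    (hnear : ∀ k i, ‖v k i - 1‖ ≤ α') {C : ℝ} (hC : 0 ≤ C) (hNE3 : LocalRate (bgReadings L M (tierBClass L M R v)) C ((L : ℝ)⁻¹))
    {Z₁ Z₀ : (k : ℕ) → Matrix υ (idx L M k × o) ℂ} {N₁ N₀ : (k : ℕ) → Matrix υ υ ℂ} {z n δZ δN Cζ₁ Cν₁ Cζ₀ Cν₀ : ℝ}
    (h₁ : SandwichLaws (fun k => calDalev L M a ha k ⊗ₖ (1 : Matrix o o ℂ)) (fun k => JpcT L M k ⊗ₖ (1 : Matrix o o ℂ)) Z₁ N₁ z n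
      (fun k => Cζ₁ * ((L : ℝ)⁻¹) ^ k) (fun k => Cν₁ * ((L : ℝ)⁻¹) ^ k))
    (h₀ : SandwichLaws (fun k => calDalev L M a ha k ⊗ₖ (1 : Matrix o o ℂ)) (fun k => JpcT L M k ⊗ₖ (1 : Matrix o o ℂ)) Z₀ N₀ z n
      (fun k => Cζ₀ * ((L : ℝ)⁻¹) ^ k) (fun k => Cν₀ * ((L : ℝ)⁻¹) ^ k))
    (hdZ : ∀ k, ‖Z₁ k - Z₀ k‖ ≤ δZ) (hdN : ∀ k, ‖N₁ k - N₀ k‖ ≤ δN)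
    (hsmall : kappaB o d a α β C (‖(a : ℂ)‖ * (α' * (2 + α') * Cst d a)) (Cst d a * (2 * z * n * δZ + z * z * δN)) < 1) :
    TowerLimitRate (fun k => Qlev L M k ⊗ₖ (1 : Matrix o o ℂ)) ((L : ℝ) ^ d)
      (fun k => (calDalev L M a ha k ⊗ₖ (1 : Matrix o o ℂ)
        + tierBPert L M R (fun k => (a : ℂ) • sitePert L M v k) (sandwichPert L M Z₁ Z₀ N₁ N₀) k)⁻¹)
      (Cpert (kappaB o d a α β C (‖(a : ℂ)‖ * (α' * (2 + α') * Cst d a)) (Cst d a * (2 * z * n * δZ + z * z * δN))) (2 * d * Cst d a)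
        (CJ d a) (C2B o d L a α β C (‖(a : ℂ)‖ * C2site d a α' (2 * (Fintype.card o : ℝ) * C))
          (C4sand d a z n Cζ₀ Cν₀ + C4sand d a z n Cζ₁ Cν₁)) 0 1) ((L : ℝ)⁻¹) :=
  tierB_rate_at_one L M a ha hL hd hreg hC (localRate_mono L M (regClass_subset_tierBClass L M R v) hNE3)
    (perturbationLaws_sitePert_of_localRate L M a ha hd hC hα' hNE3 (transTower_mem_tierBClass L M R v) hnear)
    (perturbationLaws_sandwichPert L M a ha h₁ h₀ hdZ hdN) hsmall

end Summit.QuantumFields.BalabanUV.T4Continuum.NE2BalabanLayer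

end
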